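import Literature.NumberTheory.LFunctions.UniformWeilPositivityRH
import Literature.NumberTheory.LFunctions.WeilWindowForm
import Literature.NumberTheory.LFunctions.WeilExplicitDirichlet
import HarnessLib

/-!
# The Weil-test-function REFUTATION FORMAT (rh-explicit D2 / lead R6-12 P-3)

Through the explicit-formula positivity criterion a finite computation can refute `RH` (or
`GRH(χ)`) in exactly one format: ONE compactly supported smooth (complex-valued) test function
`g` whose quadratic explicit-formula value `Re Q(g) = Re W(g ⋆ g̃)` is negative (Weil 1952, the
«lemme» p. 262: the refuting `F₀` of the sufficiency proof; survey-pos §2.1 sizes the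
support against a hypothetical off-line zero `½ + δ + iγ₀`: `2t · sinh²(δt/2) ≈ log(γ₀/2π)`).
This file packages that format as tree lemmas, so that a deposited certificate
«`g`, interval bound `Re Q(g) < 0`» (EXTREMALS/refute-format/README.md) has a statement to
discharge:

* `not_riemannHypothesis_of_weilQuadratic_re_neg` — `IsWeilTest g`, `Re Q(g) < 0` ⇒ `¬ RH`;
* `not_riemannHypothesis_of_weilWindowForm_neg` — the COMPUTABLE shape of the same statement on a
  window `[-a, a]`: the window form `P(g) + 𝓔_a(g) − M_a‖g‖²` (pole form + Dirichlet energy over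
  the FINITE prime list `log n < 2a` + archimedean jump density − Markov constant) is negative;
* `not_weilPositivityOn_of_re_neg` — the same datum kills every rung `b ≥ a` of the ladder;
* `not_riemannHypothesis_char_of_weilQuadraticChar_re_neg` — the `χ`-twisted format (primitive `χ`
  mod `q ≠ 1`), conditional on the typed explicit formula `explicit_formula_dirichlet` exactly as
  `WeilPositivityOnChar.of_riemannHypothesis` is.

Everything here is a few lines over the tree's PROVED criteria
(`riemannHypothesis_iff_forall_weilPositivityOn`, `weilWindowForm_eq_re_weilQuadratic`,
`WeilPositivityOnChar.of_riemannHypothesis`); the content of a refutation is the certified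
inequality, never these lemmas. NOTE the class: `g` must be smooth and compactly supported
(`IsWeilTest`); a negative finite-section (trigonometric-polynomial × indicator) value refutes
positivity on Yoshida's `K(a)` and needs mollification before it meets these lemmas
(cf. `not_weilSemilocalPositivityOn_two_of_gt` for the semilocal analogue).
-/

noncomputable section

open Set Literature.NumberTheory.LFunctions

set_option linter.dupNamespace false  -- the mandated namespace repeats `RiemannHypothesis`

namespace Summit.RiemannHypothesis.RiemannHypothesis.Theorems.WeilRefutationFormat

/-- A compactly supported function on `ℝ` is supported in some symmetric window `[-a, a]`, `a > 0`.
[folklore] -/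
theorem exists_tsupport_subset_Icc {g : ℝ → ℂ} (hg : HasCompactSupport g) :
    ∃ a : ℝ, 0 < a ∧ tsupport g ⊆ Icc (-a) a := by
  obtain ⟨r, hr⟩ := (Metric.isBounded_iff_subset_closedBall (0 : ℝ)).1 hg.isCompact.isBounded
  refine ⟨max r 1, lt_max_of_lt_right one_pos, fun x hx ↦ ?_⟩
  have hx' := hr hx
  rw [Metric.mem_closedBall, Real.dist_eq, sub_zero, abs_le] at hx'
  constructor
  · exact le_trans (neg_le_neg (le_max_left r 1)) hx'.1
  · exact hx'.2.trans (le_max_left r 1)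

/-- **Refutation format, `ζ`, window version.** A smooth test function supported in `[-a, a]`,
`a > 0`, with `Re Q(g) < 0` refutes the Riemann hypothesis (contrapositive of Yoshida's
criterion `riemannHypothesis_iff_forall_weilPositivityOn`, PROVED in the tree).
[cite: Weil1952FormulesExplicites, the «lemme» p. 262; Bombieri2000Weil, Thm. 2] -/
theorem not_riemannHypothesis_of_re_neg_on_window {a : ℝ} (ha : 0 < a) {g : ℝ → ℂ}
    (hg : IsWeilTest g) (hsupp : tsupport g ⊆ Icc (-a) a) (hneg : (weilQuadratic g).re < 0) :
    ¬ RiemannHypothesis := by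
  intro hRH
  have h := riemannHypothesis_iff_forall_weilPositivityOn.1 hRH a ha g hg hsupp
  linarith

/-- **Refutation format, `ζ`.** ONE smooth compactly supported (complex-valued) test function with
`Re W(g ⋆ g̃) < 0` refutes `RH`. [cite: Weil1952FormulesExplicites, the «lemme» p. 262] -/
theorem not_riemannHypothesis_of_weilQuadratic_re_neg {g : ℝ → ℂ} (hg : IsWeilTest g)
    (hneg : (weilQuadratic g).re < 0) : ¬ RiemannHypothesis := by
  obtain ⟨a, ha, hsupp⟩ := exists_tsupport_subset_Icc hg.2
  exact not_riemannHypothesis_of_re_neg_on_window ha hg hsupp hneg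

/-- **Refutation format, computable shape.** For a smooth `g` supported in `[-a, a]` the quadratic
value is the WINDOW FORM `weilWindowForm a g = P(g) + 𝓔_a(g) − M_a ∫‖g‖²` (pole form, Dirichlet
energy over the finite prime list `log n < 2a` and the archimedean jump density, Markov constant;
`weilWindowForm_eq_re_weilQuadratic`); a certified `weilWindowForm a g < 0` therefore refutes `RH`.
[cite: Bombieri2000Weil, Thm 2 (p. 193); Weil1952FormulesExplicites, p. 262] -/
theorem not_riemannHypothesis_of_weilWindowForm_neg {a : ℝ} (ha : 0 < a) {g : ℝ → ℂ}
    (hg : IsWeilTest g) (hsupp : tsupport g ⊆ Icc (-a) a) (hneg : weilWindowForm a g < 0) :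
    ¬ RiemannHypothesis := by
  rw [weilWindowForm_eq_re_weilQuadratic hg hsupp] at hneg
  exact not_riemannHypothesis_of_re_neg_on_window ha hg hsupp hneg

/-- The same datum kills the whole ladder above the window: `Re Q(g) < 0` for some smooth `g`
supported in `[-a, a]` gives `¬ WeilPositivityOn b` for every `b ≥ a` (antitonicity of the rungs,
`WeilPositivityOn.mono`). [cite: Yoshida1992, §0 (C(a) ⊆ C(b))] -/
theorem not_weilPositivityOn_of_re_neg {a b : ℝ} (hab : a ≤ b) {g : ℝ → ℂ} (hg : IsWeilTest g)
    (hsupp : tsupport g ⊆ Icc (-a) a) (hneg : (weilQuadratic g).re < 0) :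
    ¬ WeilPositivityOn b := by
  intro hb
  have h := (hb.mono hab) g hg hsupp
  linarith

/-- **Refutation format, `χ`-twisted.** For a PRIMITIVE character `χ` mod `q ≠ 1`: one smooth
compactly supported test function with `Re W_χ(g ⋆ g̃) < 0` refutes `GRH(χ)` — conditional on
the typed explicit formula with characters (`explicit_formula_dirichlet`), exactly as the tree's
`WeilPositivityOnChar.of_riemannHypothesis`. [cite: Weil1952FormulesExplicites, the «lemme» p. 262, case k = ℚ, χ primitive] -/
theorem not_riemannHypothesis_char_of_weilQuadraticChar_re_neg {q : ℕ} [NeZero q]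
    {χ : DirichletCharacter ℂ q} (hEF : explicit_formula_dirichlet) (hq : q ≠ 1)
    (hχ : χ.IsPrimitive) {g : ℝ → ℂ} (hg : IsWeilTest g)
    (hneg : (weilQuadraticChar χ g).re < 0) : ¬ χ.RiemannHypothesis := by
  intro hRH
  obtain ⟨a, _, hsupp⟩ := exists_tsupport_subset_Icc hg.2
  have h := WeilPositivityOnChar.of_riemannHypothesis hEF hq hχ hRH a g hg hsupp
  linarith

end Summit.RiemannHypothesis.RiemannHypothesis.Theorems.WeilRefutationFormat

end
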